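import Summits.BirchSwinnertonDyer.BirchSwinnertonDyer.Theorems.AdditivePotSupersingularRankOneTowerSurjOfKato
import Literature.NumberTheory.EllipticCurves.BSDSelmerPConverseSerreProofs
import HarnessLib

/-!
# KT's residual `TameRankOne` (stmt-BirchSwinnertonDyer-19984) on the SURJECTIVE rows at `p ≥ 5`, in the item's own
# binders: the LOWER half is the Eisenstein ♭-inclusion away from print; BSD_p is the ♭-IMC equality (or X + Ko) + the
# twist's r = 0 LOWER half away from print

Prover seat `bsd-potss-kmc`, gen 20 (cell `bsd-potss`; row B8 «O7-ss», tame part = class O5 = `(t′) ∪ (G)∧ss`), 2026-08-27.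
HONEST FRAMING: CONDITIONAL on every displayed hypothesis; 0 definitions, 0 named facts minted, 0 `sorry`; closes nothing;
BSD_p for no curve.

At `p ≥ 5`, `ρ̄_{E,p}` onto `GL₂(𝔽_p)` already gives the whole `p`-adic tower (Serre, *Abelian ℓ-adic representations* IV
§3.4 Lemma 3 — a tree THEOREM: `serre_hasSurjectiveModNGaloisRep_pow_holds`), so gen 20's tower-surjective kernels
(`Theorems/AdditivePotSupersingularRankOneTowerSurjOfKato.lean`) read, on KT's binders
`r_an = 1 → p ≠ 2 → Addv W p → SubTprime W p` (plus `Surj W p`, `5 ≤ p` and a free row predicate `R`), and equally on the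
`(G)∧ss` rows (`SubGss`, `e = 2`: quadratic twists of good supersingular curves):

* `missingLowerBoundAt_tameSS_surj_of_flatEisenstein_of_katoTam_of_facts` — the r = 1 LOWER half `MissingLowerBoundAt W p`
  ⟸ the Eisenstein ♭-inclusion X on the class rows (RESEARCH, the one input) ∧ Kato A161″ ∧ {Poitou–Tate ×2, local
  Euler–Poincaré, cd ≤ 2, Brink Thm 2 / Cor 1, Serre 1967} ∧ Hsieh ∧ LZZ ∧ ToricPublishedInputs;
* `bsdp_tameSS_surj_of_flatIMCEq_of_twistLower_of_katoTam_of_facts` — `BSD_p(W)` ⟸ the ♭-IMC equality on the class rows ∧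
  the r = 0 LOWER half of the class rows' twists (KT's L₀ `TameLowerHalfRankZero` territory) ∧ the same facts;
* `missingPPartAt_tameRankOne_surj_of_flatIMCEq_of_twistLower_of_katoTam_of_facts` — the same in 19984's currency.

References: [SerreAbelianLadic1968] IV §3.4 Lemma 3; [Kato2004Asterisque] Thm. 14.5 (3), Prop. 14.16 (2); [JetchevSkinnerWan2017]
§7.4.1, Thm. 3.3.1; [Hsieh2014] Thm A; [LiuZhangZhang2018] Thm 1.5.1/1.5.3; [GrossZagier1986] I.(6.3); [Serre1967GroupesPDivisibles]
§5 Prop. 8; [Brink2007] Thm 2, Cor 1.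
-/

noncomputable section

open scoped Classical

set_option linter.dupNamespace false
set_option autoImplicit false

namespace Summit.BirchSwinnertonDyer.BirchSwinnertonDyer.Theorems.UniversalToricDescentWaldspurgerFlat

open WeierstrassCurve NumberField IsDedekindDomain Field PowerSeries
  Literature.NumberTheory.EllipticCurves
  Literature.NumberTheory.EllipticCurves.ModularForms
  Literature.NumberTheory.EllipticCurves.Rank1Residual
  Literature.NumberTheory.EllipticCurves.Rank1Residual.Typed
  Literature.NumberTheory.EllipticCurves.KrizLi2019
  Literature.NumberTheory.GaloisRepresentations
  Literature.NumberTheory.GaloisCohomology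
  Summit.BirchSwinnertonDyer.Rank1Residual
  Summit.BirchSwinnertonDyer.Rank1Residual.Additive
  Summit.BirchSwinnertonDyer.Rank1Residual.X11b
  Summit.BirchSwinnertonDyer.Rank1Residual.X11b.AcSelmer
  Summit.BirchSwinnertonDyer.Rank1Residual.X11b.Halves
  Summit.BirchSwinnertonDyer.Rank1Residual.X11b.CongruenceLimit
  Summit.BirchSwinnertonDyer.BirchSwinnertonDyer.Theses.UniversalToricDescent
  Summit.BirchSwinnertonDyer.BirchSwinnertonDyer.Theorems.AdditivePotSupersingularControl

section TameSurj

variable (p : ℕ) [Fact p.Prime] (hp5 : 5 ≤ p) (R : WeierstrassCurve ℚ → Prop)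

include hp5

/-- **The r = 1 LOWER half on the TAME potentially supersingular SURJECTIVE rows at `p ≥ 5` from the Eisenstein
♭-inclusion alone (modulo print)**, in KT's binders: for any row predicate `R`, on `r_an = 1`, `p ≠ 2`, `Addv W p`,
`SubTameSS W p` (`(t′)` or `(G)∧ss`), `ρ̄_{E,p}` onto, `R W`: `MissingLowerBoundAt W p` ⟸ `hIncl` (X on the class rows) ∧ A161″ ∧
the seven cohomological facts ∧ Hsieh ∧ LZZ ∧ ToricPublishedInputs. Tower surjectivity by Serre (tree theorem).
CONDITIONAL; closes nothing. [cite: SerreAbelianLadic1968, Ch. IV §3.4, Lemma 3]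
[cite: JetchevSkinnerWan2017, §7.4.1 and Thm. 3.3.1 (arXiv:1512.06894)] [cite: Kato2004Asterisque, Thm. 14.5 (3), Prop. 14.16 (2)]
[cite: Serre1967GroupesPDivisibles, §5 Prop. 8] -/
theorem missingLowerBoundAt_tameSS_surj_of_flatEisenstein_of_katoTam_of_facts
    (hA : Hsieh2014.thmA_exists_isHsiehLFunction_unrPeriod_anyLevel)
    (hL : LiuZhangZhang2018.thm151_thm153_modularCurve_heegnerVector_additive)
    (hF : ToricPublishedInputs)
    (hKatoT : Kato2004.rankZero_padicValNat_sha_add_padicValNat_tamagawa_le_of_additive_potGood_of_imageContainsSL2)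
    (hPT : ∀ (K : Type) [Field K] [NumberField K], poitouTate_selmerStructure_duality K)
    (hPT2 : ∀ (K : Type) [Field K] [NumberField K], poitouTate_sha_tateDual K)
    (hEP : ∀ (K : Type) [Field K] [NumberField K] (v : HeightOneSpectrum (𝓞 K)),
      localEulerPoincareCharacteristic (v.adicCompletion K))
    (hcd : fieldCdLE_two_of_numberField)
    (hBr : ∀ (K : Type) [Field K] [NumberField K] (p : ℕ) [Fact p.Prime],
      ZpExtension.decomp_not_le_kerSubgroup_of_isAnticyclotomic K p)
    (hBr2 : ∀ (K : Type) [Field K] [NumberField K] (p : ℕ) [Fact p.Prime],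
      ZpExtension.decomp_not_le_kerSubgroup_above_of_isAnticyclotomic K p)
    (hS : Serre1967.noStableDivisibleLine_of_potentiallySupersingular)
    (hIncl : ∀ (W : WeierstrassCurve ℚ) [W.IsElliptic] [W.IsGloballyMinimal] (N : ℕ) [NeZero N] (K : Type) [Field K]
      [NumberField K] (Dt : ModularParametrizationData W N),
      R W → ClassO5 W p → W.HasSurjectiveModNGaloisRep p → W.analyticRank = 1 →
      W.conductorNorm ℤ = N → IsImaginaryQuadratic K → SatisfiesHeegnerHypothesis N K →
      ∀ (κ : ZpExtension K p), κ.IsAnticyclotomic → ∀ (γ : Field.absoluteGaloisGroup K) [Fact (κ.IsTopGenerator γ)]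
        (𝔭 : HeightOneSpectrum (𝓞 K)), ((p : ℕ) : 𝓞 K) ∈ 𝔭.asIdeal → 𝔭.asIdeal.ramificationIdx (𝓞 ℚ) = 1 →
        𝔭.asIdeal.inertiaDeg (𝓞 ℚ) = 1 → ∀ (𝔭' : HeightOneSpectrum (𝓞 K)), ((p : ℕ) : 𝓞 K) ∈ 𝔭'.asIdeal → 𝔭' ≠ 𝔭 →
        ∀ (ι' : PadicAlgCl p ≃+* ℂ), SchneiderFree.BranchInducesPrime p ι' 𝔭 →
        ∀ (ΩK : ℂ) (Ωp : ℂ_[p]) (Q : PowerSeries (PadicComplexInt p)), ΩK ≠ 0 → Ωp ≠ 0 →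
          R1.IsBDPLFunctionInt p ι' 𝔭 κ γ Dt.f ΩK Ωp Q →
          (XAc.charIdeal (W.baseChange K) p κ 𝔭' ∅ γ).map (PowerSeries.map (R1.toCpInt p)) ≤ Ideal.span {Q}) :
    ∀ (W : WeierstrassCurve ℚ) [W.IsElliptic] [W.IsGloballyMinimal], W.analyticRank = 1 → p ≠ 2 → Addv W p →
      SubTameSS W p → W.HasSurjectiveModNGaloisRep p → R W → MissingLowerBoundAt W p := by
  intro W _ _ hr hp2 hadd hT hsurj hR
  have hO5 : ClassO5 W p := ⟨hp2, hadd, hT⟩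
  have htower : ∀ n : ℕ, W.HasSurjectiveModNGaloisRep (p ^ n : ℕ) :=
    serre_hasSurjectiveModNGaloisRep_pow_holds W p hp5 hsurj
  refine missingLowerBoundAt_potSS_towerSurj_of_flatEisenstein_of_katoTam_of_facts p R
    hA hL hF hKatoT hPT hPT2 hEP hcd hBr hBr2 hS ?_ W hR (Or.inl hO5) htower hr
  intro V _ _ N _ K _ _ Dt hRV hclsV htV hrV hN hK hHN κ hκ γ _ 𝔭 h𝔭 he hf 𝔭' h𝔭' hne ι' hind ΩK Ωp Q hΩK hΩp hBDP
  have hO5V : ClassO5 V p := hclsV.elim id (fun h6 ↦ absurd h6.p_eq_three (by omega))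
  have h1 := htV 1
  simp only [pow_one] at h1
  exact hIncl V N K Dt hRV hO5V h1 hrV hN hK hHN κ hκ γ 𝔭 h𝔭 he hf 𝔭' h𝔭' hne ι' hind ΩK Ωp Q hΩK hΩp hBDP

/-- **`BSD_p` on the TAME potentially supersingular SURJECTIVE rows at `p ≥ 5` from the ♭-IMC equality and the twist's
r = 0 LOWER half (modulo print)**, in KT's binders: `BSD_p(W)` ⟸ `hEq` (the ♭-(∅,0)-IMC equality on the class rows —
RESEARCH) ∧ `hTwLo` (`MissingLowerBoundAt` of globally minimal models of the rank-zero twists of class rows — KT's L₀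
territory) ∧ A161″ ∧ the seven cohomological facts ∧ Hsieh ∧ LZZ ∧ ToricPublishedInputs. CONDITIONAL; closes nothing.
[cite: SerreAbelianLadic1968, Ch. IV §3.4, Lemma 3] [cite: JetchevSkinnerWan2017, §7.4.1 and Thm. 3.3.1 (arXiv:1512.06894)]
[cite: Kato2004Asterisque, Thm. 14.5 (3), Prop. 14.16 (2)] [cite: Serre1967GroupesPDivisibles, §5 Prop. 8] -/
theorem bsdp_tameSS_surj_of_flatIMCEq_of_twistLower_of_katoTam_of_facts
    (hA : Hsieh2014.thmA_exists_isHsiehLFunction_unrPeriod_anyLevel)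
    (hL : LiuZhangZhang2018.thm151_thm153_modularCurve_heegnerVector_additive)
    (hF : ToricPublishedInputs)
    (hKatoT : Kato2004.rankZero_padicValNat_sha_add_padicValNat_tamagawa_le_of_additive_potGood_of_imageContainsSL2)
    (hPT : ∀ (K : Type) [Field K] [NumberField K], poitouTate_selmerStructure_duality K)
    (hPT2 : ∀ (K : Type) [Field K] [NumberField K], poitouTate_sha_tateDual K)
    (hEP : ∀ (K : Type) [Field K] [NumberField K] (v : HeightOneSpectrum (𝓞 K)),
      localEulerPoincareCharacteristic (v.adicCompletion K))
    (hcd : fieldCdLE_two_of_numberField)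
    (hBr : ∀ (K : Type) [Field K] [NumberField K] (p : ℕ) [Fact p.Prime],
      ZpExtension.decomp_not_le_kerSubgroup_of_isAnticyclotomic K p)
    (hBr2 : ∀ (K : Type) [Field K] [NumberField K] (p : ℕ) [Fact p.Prime],
      ZpExtension.decomp_not_le_kerSubgroup_above_of_isAnticyclotomic K p)
    (hS : Serre1967.noStableDivisibleLine_of_potentiallySupersingular)
    (hEq : ∀ (W : WeierstrassCurve ℚ) [W.IsElliptic] [W.IsGloballyMinimal] (N : ℕ) [NeZero N] (K : Type) [Field K]
      [NumberField K] (Dt : ModularParametrizationData W N),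
      R W → ClassO5 W p → W.HasSurjectiveModNGaloisRep p → W.analyticRank = 1 →
      W.conductorNorm ℤ = N → IsImaginaryQuadratic K → SatisfiesHeegnerHypothesis N K →
      ∀ (κ : ZpExtension K p), κ.IsAnticyclotomic → ∀ (γ : Field.absoluteGaloisGroup K) [Fact (κ.IsTopGenerator γ)]
        (𝔭 : HeightOneSpectrum (𝓞 K)), ((p : ℕ) : 𝓞 K) ∈ 𝔭.asIdeal → 𝔭.asIdeal.ramificationIdx (𝓞 ℚ) = 1 →
        𝔭.asIdeal.inertiaDeg (𝓞 ℚ) = 1 → ∀ (𝔭' : HeightOneSpectrum (𝓞 K)), ((p : ℕ) : 𝓞 K) ∈ 𝔭'.asIdeal → 𝔭' ≠ 𝔭 →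
        ∀ (ι' : PadicAlgCl p ≃+* ℂ), SchneiderFree.BranchInducesPrime p ι' 𝔭 →
        ∀ (ΩK : ℂ) (Ωp : ℂ_[p]) (Q : PowerSeries (PadicComplexInt p)), ΩK ≠ 0 → Ωp ≠ 0 →
          R1.IsBDPLFunctionInt p ι' 𝔭 κ γ Dt.f ΩK Ωp Q →
          (XAc.charIdeal (W.baseChange K) p κ 𝔭' ∅ γ).map (PowerSeries.map (R1.toCpInt p)) = Ideal.span {Q})
    (hTwLo : ∀ (W : WeierstrassCurve ℚ) [W.IsElliptic] [W.IsGloballyMinimal] (N : ℕ) [NeZero N] (K : Type) [Field K]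
      [NumberField K] (Wd : WeierstrassCurve ℚ) [Wd.IsElliptic] [Wd.IsGloballyMinimal],
      R W → ClassO5 W p → W.HasSurjectiveModNGaloisRep p → W.analyticRank = 1 →
      W.conductorNorm ℤ = N → IsImaginaryQuadratic K → SatisfiesHeegnerHypothesis N K → Odd (NumberField.discr K) →
      NumberField.discr K < -4 → (∃ C : VariableChange ℚ, C • W.quadraticTwist (NumberField.discr K : ℚ) = Wd) →
      (W.quadraticTwist (NumberField.discr K : ℚ)).entireLFunction 1 ≠ 0 → MissingLowerBoundAt Wd p) :
    ∀ (W : WeierstrassCurve ℚ) [W.IsElliptic] [W.IsGloballyMinimal], W.analyticRank = 1 → p ≠ 2 → Addv W p →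
      SubTameSS W p → W.HasSurjectiveModNGaloisRep p → R W → BSDp W p := by
  intro W _ _ hr hp2 hadd hT hsurj hR
  have hO5 : ClassO5 W p := ⟨hp2, hadd, hT⟩
  have htower : ∀ n : ℕ, W.HasSurjectiveModNGaloisRep (p ^ n : ℕ) :=
    serre_hasSurjectiveModNGaloisRep_pow_holds W p hp5 hsurj
  refine bsdp_potSS_towerSurj_of_flatIMCEq_of_twistLower_of_katoTam_of_facts p R
    hA hL hF hKatoT hPT hPT2 hEP hcd hBr hBr2 hS ?_ ?_ W hR (Or.inl hO5) htower hr
  · intro V _ _ N _ K _ _ Dt hRV hclsV htV hrV hN hK hHN κ hκ γ _ 𝔭 h𝔭 he hf 𝔭' h𝔭' hne ι' hind ΩK Ωp Q hΩK hΩp hBDP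
    have hO5V : ClassO5 V p := hclsV.elim id (fun h6 ↦ absurd h6.p_eq_three (by omega))
    have h1 := htV 1
    simp only [pow_one] at h1
    exact hEq V N K Dt hRV hO5V h1 hrV hN hK hHN κ hκ γ 𝔭 h𝔭 he hf 𝔭' h𝔭' hne ι' hind ΩK Ωp Q hΩK hΩp hBDP
  · intro V _ _ N _ K _ _ Wd _ _ hRV hclsV htV hrV hN hK hHN hodd hd4 hC hLt
    have hO5V : ClassO5 V p := hclsV.elim id (fun h6 ↦ absurd h6.p_eq_three (by omega))
    have h1 := htV 1
    simp only [pow_one] at h1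
    exact hTwLo V N K Wd hRV hO5V h1 hrV hN hK hHN hodd hd4 hC hLt

/-- **KT's residual `TameRankOne` (19984) on the SURJECTIVE rows at `p ≥ 5`, in its own currency `MissingPPartAt W p`**:
from the hypotheses of `bsdp_tameSS_surj_of_flatIMCEq_of_twistLower_of_katoTam_of_facts` (`Ш(E/ℚ)` finite by GZK), on
the binders `r_an = 1 → p ≠ 2 → Addv W p → SubTprime W p` with `ρ̄_{E,p}` onto and `R W`. CONDITIONAL; closes nothing (the
item is class-wide and declared residual; this is its reduction on the onto rows to ONE analytic statement + KT's L₀ on the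
twists). [cite: SerreAbelianLadic1968, Ch. IV §3.4, Lemma 3] [cite: JetchevSkinnerWan2017, §7.4.1 (arXiv:1512.06894 p. 30)]
[cite: Kato2004Asterisque, Thm. 14.5 (3), Prop. 14.16 (2)] -/
theorem missingPPartAt_tameRankOne_surj_of_flatIMCEq_of_twistLower_of_katoTam_of_facts
    (hA : Hsieh2014.thmA_exists_isHsiehLFunction_unrPeriod_anyLevel)
    (hL : LiuZhangZhang2018.thm151_thm153_modularCurve_heegnerVector_additive)
    (hF : ToricPublishedInputs)
    (hKatoT : Kato2004.rankZero_padicValNat_sha_add_padicValNat_tamagawa_le_of_additive_potGood_of_imageContainsSL2)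
    (hPT : ∀ (K : Type) [Field K] [NumberField K], poitouTate_selmerStructure_duality K)
    (hPT2 : ∀ (K : Type) [Field K] [NumberField K], poitouTate_sha_tateDual K)
    (hEP : ∀ (K : Type) [Field K] [NumberField K] (v : HeightOneSpectrum (𝓞 K)),
      localEulerPoincareCharacteristic (v.adicCompletion K))
    (hcd : fieldCdLE_two_of_numberField)
    (hBr : ∀ (K : Type) [Field K] [NumberField K] (p : ℕ) [Fact p.Prime],
      ZpExtension.decomp_not_le_kerSubgroup_of_isAnticyclotomic K p)
    (hBr2 : ∀ (K : Type) [Field K] [NumberField K] (p : ℕ) [Fact p.Prime],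
      ZpExtension.decomp_not_le_kerSubgroup_above_of_isAnticyclotomic K p)
    (hS : Serre1967.noStableDivisibleLine_of_potentiallySupersingular)
    (hEq : ∀ (W : WeierstrassCurve ℚ) [W.IsElliptic] [W.IsGloballyMinimal] (N : ℕ) [NeZero N] (K : Type) [Field K]
      [NumberField K] (Dt : ModularParametrizationData W N),
      R W → ClassO5 W p → W.HasSurjectiveModNGaloisRep p → W.analyticRank = 1 →
      W.conductorNorm ℤ = N → IsImaginaryQuadratic K → SatisfiesHeegnerHypothesis N K →
      ∀ (κ : ZpExtension K p), κ.IsAnticyclotomic → ∀ (γ : Field.absoluteGaloisGroup K) [Fact (κ.IsTopGenerator γ)]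
        (𝔭 : HeightOneSpectrum (𝓞 K)), ((p : ℕ) : 𝓞 K) ∈ 𝔭.asIdeal → 𝔭.asIdeal.ramificationIdx (𝓞 ℚ) = 1 →
        𝔭.asIdeal.inertiaDeg (𝓞 ℚ) = 1 → ∀ (𝔭' : HeightOneSpectrum (𝓞 K)), ((p : ℕ) : 𝓞 K) ∈ 𝔭'.asIdeal → 𝔭' ≠ 𝔭 →
        ∀ (ι' : PadicAlgCl p ≃+* ℂ), SchneiderFree.BranchInducesPrime p ι' 𝔭 →
        ∀ (ΩK : ℂ) (Ωp : ℂ_[p]) (Q : PowerSeries (PadicComplexInt p)), ΩK ≠ 0 → Ωp ≠ 0 →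
          R1.IsBDPLFunctionInt p ι' 𝔭 κ γ Dt.f ΩK Ωp Q →
          (XAc.charIdeal (W.baseChange K) p κ 𝔭' ∅ γ).map (PowerSeries.map (R1.toCpInt p)) = Ideal.span {Q})
    (hTwLo : ∀ (W : WeierstrassCurve ℚ) [W.IsElliptic] [W.IsGloballyMinimal] (N : ℕ) [NeZero N] (K : Type) [Field K]
      [NumberField K] (Wd : WeierstrassCurve ℚ) [Wd.IsElliptic] [Wd.IsGloballyMinimal],
      R W → ClassO5 W p → W.HasSurjectiveModNGaloisRep p → W.analyticRank = 1 →
      W.conductorNorm ℤ = N → IsImaginaryQuadratic K → SatisfiesHeegnerHypothesis N K → Odd (NumberField.discr K) →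
      NumberField.discr K < -4 → (∃ C : VariableChange ℚ, C • W.quadraticTwist (NumberField.discr K : ℚ) = Wd) →
      (W.quadraticTwist (NumberField.discr K : ℚ)).entireLFunction 1 ≠ 0 → MissingLowerBoundAt Wd p) :
    ∀ (W : WeierstrassCurve ℚ) [W.IsElliptic] [W.IsGloballyMinimal], W.analyticRank = 1 → p ≠ 2 → Addv W p →
      SubTprime W p → W.HasSurjectiveModNGaloisRep p → R W → MissingPPartAt W p := by
  intro W _ _ hr hp2 hadd hT hsurj hR
  have hGZK : rank_eq_analyticRank_of_analyticRank_le_one := hF.2.2.1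
  haveI : Finite W.sha := (hGZK W (by omega)).2
  exact missingPPartAt_of_bsdp W p
    (bsdp_tameSS_surj_of_flatIMCEq_of_twistLower_of_katoTam_of_facts p hp5 R hA hL hF hKatoT hPT hPT2 hEP hcd hBr hBr2
      hS hEq hTwLo W hr hp2 hadd (Or.inr hT) hsurj hR)

end TameSurj

end Summit.BirchSwinnertonDyer.BirchSwinnertonDyer.Theorems.UniversalToricDescentWaldspurgerFlat

end
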